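import Summits.BirchSwinnertonDyer.Rank1Residual.GaloisImage.LocalThreeTorsionDecider
import Literature.Barriers.BirchSwinnertonDyer.RankNotSumOfLocalInvariantsF3
import Mathlib.NumberTheory.Padics.HeightOneSpectrum
import HarnessLib

/-!
# The local `3`-torsion count at the PLACE of `3`, visibility currency: `#E(ℚ_v)[3]` as a KERNEL
# number from n1011-p17's `threeTorsionCheck` decider (team n1011, row T-VIS3 (iv)-PREP; seat p18 GEN 8)

HONEST FRAMING (cell `b2b-bsdres`, run/shared/lean/b2b/bsd-rank1-residual/, verbatim in every
file): the goal of the cell is to DELETE the COMBINATION-SHAPED residual classes of the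
Birch–Swinnerton-Dyer formula for ALL analytic-rank `≤ 1` elliptic curves over `ℚ` — "full BSD
formula for every rank `≤ 1` curve in class `C`" assembled STRICTLY from published theorems — so
that the rank-`≤ 1` remainder becomes exactly the CONSTRUCTION-SHAPED classes, which are TYPED
(missing-input `Prop`s), NOT attempted. This is not "finishing BSD". Team n1011 (N10/N11 = X4 ∧
`p = 3`, research route; ROW T-VIS3 = r1 ROUTE-1 §40.3 (d) / R1-74, lead R5-77 (e): the VISIBLE /
CONGRUENCE lower bound at additive `3`). THIS FILE IS A TOOL: theorems only (no definition, no named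
fact, no `sorry`); it closes nothing, books nothing, moves no mark / label / count.

## What and why

The tree's visibility engine (x11a gens 9–10, `Literature/…/CongruenceVisibility*.lean`,
`WeierstrassCurve.exists_sha_ne_zero_of_congr_of_rank` / `…_of_places`) PAYS the place `v ∣ p` of a
`p`-congruence certificate with the local factor `#E′(K_v)[p] · #(𝓞_v / p)`; its local binder is
spelled

  `hloc : Nat.card (nsmulAddMonoidHom p : (W'.baseChange (v.adicCompletion ℚ)).toAffine.Point →+ _).ker = 1`

(the kernel of multiplication by `p` on the `v.adicCompletion ℚ`-points).  At `p = 3` the tree ALSO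
holds n1011-p17's KERNEL DECIDER (`GaloisImage/LocalThreeTorsionDecider.lean`,
`LocalTorsion3.natCard_threeTorsion_eq_of_check`): `threeTorsionCheck a₁ … a₆ k cert = some S`
(integer arithmetic, `decide +kernel`) gives `#E(ℚ₃)[3] = 1 + 2S`, spelled

  `Nat.card {Q : (W.baseChange ℚ_[3]).toAffine.Point // (3 : ℕ) • Q = 0} = 1 + 2 * S`

(route 1's `ht` currency).  The two currencies were not connected in the tree.  This file is the
bridge, so that on every T-VIS3 row the (h5) column of r1's §40.3 (d) — `E′(ℚ₃)[3] = 0`, today the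
EVIDENCE column `g28_h0q3` (48/48) — is discharged IN THE KERNEL, one `decide +kernel` per partner:

* `natCard_ker_nsmulAddMonoidHom_eq_of_addEquiv` — `#ker [n]` is transported along any `A ≃+ B`
  into the subtype currency `{b // n • b = 0}` (pure algebra);
* `natCard_ker_nsmul_adicCompletion_eq_natCard_torsion_padic` — for `E/ℚ`, a finite place `v` of
  `𝓞 ℚ` with `primesEquiv v = p` and any `n`:
  `#ker([n] on E(ℚ_v)) = #{Q ∈ E(ℚ_[p]) : n • Q = 0}`, transport of points along Mathlib's
  continuous `ℚ`-algebra isomorphism `adicCompletion.padicEquiv v : ℚ_v ≃A[ℚ] ℚ_[p]`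
  (`Literature.Barriers.BirchSwinnertonDyer.pointEquivOfAlgEquiv`, Mathlib `Affine.Point.map`);
* `natCard_ker_nsmul_three_adicCompletion_eq_of_check` — THE CONSUMER: for integers `a₁ … a₆` with
  `Δ ≠ 0` and `threeTorsionCheck a₁ … a₆ k cert = some S`, at the place `v` of `3`:
  `#ker([3] on E(ℚ_v)) = 1 + 2S` for any `W/ℚ` with `W = ⟨a₁, …, a₆⟩` (the record binder shape
  `hW' : W' = ⟨…⟩` of the tree's visibility records); shapes `…_eq_one_of_check` (`S = 0`, literally
  the visibility binder `hloc` at `v = 3`) and `…_eq_[one_]of_intModel_of_check` (`integralModelInt`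
  currency, for partners given by a minimal model);
* `natCard_ker_nsmul_three_adicCompletion_eq_one_2718f1` — ONE instance: the rank-2 partner
  `2718f1 = [1, -1, 0, -99, 409]` of the N11 row `2718d1` (r1 ROUTE-1 §40.3 V40: `2718d1 ~ 2718f1`,
  `N′ = N = 2·3²·151`; Cremona–Mazur 2000 Table 1 pair 2718D–F) has `E′(ℚ_v)[3] = 0` at the place
  of `3`: certificate `k = 2`, `cert = [(4, 1, 3, 0)]`, `S = 0` (p17's `census/loc3t_cert2.py`
  UNCHANGED on the bsd-rank2-observatory certificate model `certs/rank2/2718f1.json`; the kernel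
  re-verifies by `decide +kernel`; the same script reproduces the tree's `2718d1` certificate
  `k = 4`, `[(13, 1, 3, 0)]`).

NOT claimed: the local binder at places `v ≠ 3` (governed by `a_v`, `c_v`: binder, or x11c's
`natCard_ker_nsmul_adicCompletion_eq_one_of_mult_of_not_dvd_padicValRat_j` at a multiplicative
`v = p`), any congruence `E[3] ≅ E′[3]` (p07 / r2 lane), any rank certificate, any record.

References: [SilvermanAEC2009] VII.3, Ex. 3.7 (division polynomial `Ψ₃`); [Serre1973] Ch. II §3.3
(squares in `ℚ₃`); [CremonaMazur2000] §3 and Table 1 (the pair 2718D–F); [Cremona2006] (labels,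
models).
-/

set_option autoImplicit false

noncomputable section

open scoped Classical NumberField
open IsDedekindDomain NumberField WeierstrassCurve Rat.HeightOneSpectrum
  Literature.Barriers.BirchSwinnertonDyer

namespace Summit.BirchSwinnertonDyer.Rank1Residual.GaloisImage.LocalTorsion3

/-! ### §1. Transport of `#ker [n]` along an additive isomorphism -/

/-- **`#ker [n]` is invariant under `A ≃+ B`**, landing in the subtype currency `{b // n • b = 0}`
(`e (n • a) = n • e a`, `e a = 0 ↔ a = 0`). [folklore] -/
theorem natCard_ker_nsmulAddMonoidHom_eq_of_addEquiv {A B : Type*} [AddCommGroup A]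
    [AddCommGroup B] (e : A ≃+ B) (n : ℕ) :
    Nat.card (nsmulAddMonoidHom n : A →+ A).ker = Nat.card {b : B // n • b = 0} := by
  refine Nat.card_congr (Equiv.subtypeEquiv e.toEquiv fun a => ?_)
  rw [AddMonoidHom.mem_ker, nsmulAddMonoidHom_apply, AddEquiv.toEquiv_eq_coe, AddEquiv.coe_toEquiv,
    ← map_nsmul, e.map_eq_zero_iff]

/-- The same in the kernel currency on both sides. [folklore] -/
theorem natCard_ker_nsmulAddMonoidHom_congr {A B : Type*} [AddCommGroup A] [AddCommGroup B]
    (e : A ≃+ B) (n : ℕ) :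
    Nat.card (nsmulAddMonoidHom n : A →+ A).ker = Nat.card (nsmulAddMonoidHom n : B →+ B).ker := by
  rw [natCard_ker_nsmulAddMonoidHom_eq_of_addEquiv e n,
    natCard_ker_nsmulAddMonoidHom_eq_of_addEquiv (AddEquiv.refl B) n]

/-! ### §2. `E(ℚ_v)[n]` versus `E(ℚ_[p])[n]` along `adicCompletion.padicEquiv` -/

/-- **The two local-torsion currencies agree**: for `E = W/ℚ`, a finite place `v` of `𝓞 ℚ` above the
rational prime `p` (`primesEquiv v = p`) and any `n`,
`#ker([n] : E(ℚ_v) → E(ℚ_v)) = #{Q ∈ E(ℚ_[p]) : n • Q = 0}` — transport of points along Mathlib's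
continuous `ℚ`-algebra isomorphism `adicCompletion.padicEquiv v : v.adicCompletion ℚ ≃A[ℚ] ℚ_[p]`
(`pointEquivOfAlgEquiv`: `Affine.Point.map` both ways). Left: the `hloc` currency of the tree's
visibility certificates (`exists_sha_ne_zero_of_congr_of_rank`); right: route 1's `ht` currency and
the output currency of n1011-p17's decider. [folklore] -/
theorem natCard_ker_nsmul_adicCompletion_eq_natCard_torsion_padic (W : WeierstrassCurve ℚ)
    (v : HeightOneSpectrum (𝓞 ℚ)) {p : ℕ} [Fact p.Prime] (hv : (primesEquiv v : ℕ) = p) (n : ℕ) :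
    Nat.card (nsmulAddMonoidHom n : (W.baseChange (v.adicCompletion ℚ)).toAffine.Point →+
      (W.baseChange (v.adicCompletion ℚ)).toAffine.Point).ker =
      Nat.card {Q : (W.baseChange ℚ_[p]).toAffine.Point // n • Q = 0} := by
  subst hv
  exact natCard_ker_nsmulAddMonoidHom_eq_of_addEquiv
    (pointEquivOfAlgEquiv W (adicCompletion.padicEquiv v).toAlgEquiv) n

/-! ### §3. The consumer at the place of `3`: `hloc` from `threeTorsionCheck` -/

/-- **`#E(ℚ_v)[3] = 1 + 2S` at the place `v` of `3` from the decider**: for integers `a₁, …, a₆`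
with `Δ ≠ 0` and `threeTorsionCheck a₁ a₂ a₃ a₄ a₆ k cert = some S` (n1011-p17,
`LocalThreeTorsionDecider`), the kernel of `[3]` on the `ℚ_v`-points of any `W/ℚ` with
`W = ⟨a₁, …, a₆⟩` (the record binder shape `hW`) has `1 + 2S` elements.
[cite: SilvermanAEC2009, VII.3 and Ex. 3.7] -/
theorem natCard_ker_nsmul_three_adicCompletion_eq_of_check (a₁ a₂ a₃ a₄ a₆ : ℤ)
    (hΔ : (⟨a₁, a₂, a₃, a₄, a₆⟩ : WeierstrassCurve ℤ).Δ ≠ 0) {k S : ℕ}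
    {cert : List (ℤ × ℕ × ℕ × ℕ)} (h : threeTorsionCheck a₁ a₂ a₃ a₄ a₆ k cert = some S)
    (W : WeierstrassCurve ℚ) (hW : W = ⟨a₁, a₂, a₃, a₄, a₆⟩)
    {v : HeightOneSpectrum (𝓞 ℚ)} (hv : (primesEquiv v : ℕ) = 3) :
    Nat.card (nsmulAddMonoidHom 3 : (W.baseChange (v.adicCompletion ℚ)).toAffine.Point →+
      (W.baseChange (v.adicCompletion ℚ)).toAffine.Point).ker = 1 + 2 * S := by
  haveI : Fact (Nat.Prime 3) := ⟨Nat.prime_three⟩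
  subst hW
  rw [natCard_ker_nsmul_adicCompletion_eq_natCard_torsion_padic _ v hv 3]
  exact natCard_threeTorsion_eq_of_check a₁ a₂ a₃ a₄ a₆ hΔ h

/-- **The visibility binder `hloc` AT THE PLACE OF 3, from the decider** (`S = 0`):
`Nat.card (ker [3] : E(ℚ_v)) = 1` for any `W/ℚ` with `W = ⟨a₁, …, a₆⟩`, `Δ ≠ 0` and
`threeTorsionCheck a₁ … a₆ k cert = some 0` — literally the hypothesis of
`exists_sha_ne_zero_of_congr_of_rank` / `…_of_places` at the (paid) place `v ∣ 3`, for the partner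
given by the record binder `hW' : W' = ⟨…⟩`. [cite: SilvermanAEC2009, VII.3 and Ex. 3.7] -/
theorem natCard_ker_nsmul_three_adicCompletion_eq_one_of_check (a₁ a₂ a₃ a₄ a₆ : ℤ)
    (hΔ : (⟨a₁, a₂, a₃, a₄, a₆⟩ : WeierstrassCurve ℤ).Δ ≠ 0) {k : ℕ}
    {cert : List (ℤ × ℕ × ℕ × ℕ)} (h : threeTorsionCheck a₁ a₂ a₃ a₄ a₆ k cert = some 0)
    (W : WeierstrassCurve ℚ) (hW : W = ⟨a₁, a₂, a₃, a₄, a₆⟩)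
    {v : HeightOneSpectrum (𝓞 ℚ)} (hv : (primesEquiv v : ℕ) = 3) :
    Nat.card (nsmulAddMonoidHom 3 : (W.baseChange (v.adicCompletion ℚ)).toAffine.Point →+
      (W.baseChange (v.adicCompletion ℚ)).toAffine.Point).ker = 1 := by
  rw [natCard_ker_nsmul_three_adicCompletion_eq_of_check a₁ a₂ a₃ a₄ a₆ hΔ h W hW hv]

/-- **`integralModelInt` currency**: for `W/ℚ` globally minimal with integer model `⟨a₁, …, a₆⟩`
and `threeTorsionCheck a₁ … a₆ k cert = some S`, `#ker([3] : E(ℚ_v)) = 1 + 2S` at the place `v` of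
`3`. [cite: SilvermanAEC2009, VII.3 and Ex. 3.7] -/
theorem natCard_ker_nsmul_three_adicCompletion_eq_of_intModel_of_check (a₁ a₂ a₃ a₄ a₆ : ℤ)
    (W : WeierstrassCurve ℚ) [W.IsElliptic] [W.IsGloballyMinimal]
    (hI : W.integralModelInt = ⟨a₁, a₂, a₃, a₄, a₆⟩) {k S : ℕ} {cert : List (ℤ × ℕ × ℕ × ℕ)}
    (h : threeTorsionCheck a₁ a₂ a₃ a₄ a₆ k cert = some S)
    {v : HeightOneSpectrum (𝓞 ℚ)} (hv : (primesEquiv v : ℕ) = 3) :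
    Nat.card (nsmulAddMonoidHom 3 : (W.baseChange (v.adicCompletion ℚ)).toAffine.Point →+
      (W.baseChange (v.adicCompletion ℚ)).toAffine.Point).ker = 1 + 2 * S := by
  haveI : Fact (Nat.Prime 3) := ⟨Nat.prime_three⟩
  rw [natCard_ker_nsmul_adicCompletion_eq_natCard_torsion_padic W v hv 3]
  exact natCard_threeTorsion_eq_of_intModel_of_check a₁ a₂ a₃ a₄ a₆ W hI h

/-- **`integralModelInt` currency, `S = 0`**: the visibility binder `hloc` at the place of `3` for a
globally minimal `W/ℚ` with integer model `⟨a₁, …, a₆⟩` and `threeTorsionCheck … = some 0`.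
[cite: SilvermanAEC2009, VII.3 and Ex. 3.7] -/
theorem natCard_ker_nsmul_three_adicCompletion_eq_one_of_intModel_of_check (a₁ a₂ a₃ a₄ a₆ : ℤ)
    (W : WeierstrassCurve ℚ) [W.IsElliptic] [W.IsGloballyMinimal]
    (hI : W.integralModelInt = ⟨a₁, a₂, a₃, a₄, a₆⟩) {k : ℕ} {cert : List (ℤ × ℕ × ℕ × ℕ)}
    (h : threeTorsionCheck a₁ a₂ a₃ a₄ a₆ k cert = some 0)
    {v : HeightOneSpectrum (𝓞 ℚ)} (hv : (primesEquiv v : ℕ) = 3) :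
    Nat.card (nsmulAddMonoidHom 3 : (W.baseChange (v.adicCompletion ℚ)).toAffine.Point →+
      (W.baseChange (v.adicCompletion ℚ)).toAffine.Point).ker = 1 := by
  rw [natCard_ker_nsmul_three_adicCompletion_eq_of_intModel_of_check a₁ a₂ a₃ a₄ a₆ W hI h hv]

/-! ### §4. Instance: the V40 partner `2718f1` at the place of `3` -/

/-- **`2718f1` (`[1, -1, 0, -99, 409]`, `N = 2718 = 2·3²·151`; the rank-2 partner of the N11 row
`2718d1` in r1's V40 table, Cremona–Mazur 2000 Table 1 pair 2718D–F): `E′(ℚ_v)[3] = 0` at the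
place `v` of `3`** — the T-VIS3 binder `hloc` at the paid place, IN THE KERNEL, in the record binder
shape `hW' : W' = ⟨1, -1, 0, -99, 409⟩`.  Certificate (p17's `loc3t_cert2.py` unchanged on the
bsd-rank2-observatory model): precision `k = 2`, one Hensel ball `(c, m, N, w) = (4, 1, 3, 0)` with
`g(4)` a non-square in `ℚ₃` (`S = 0`), re-verified by `decide +kernel`; `Δ = -2²·3⁷·151 ≠ 0` by
`decide`. Per partner; nothing booked.
[cite: CremonaMazur2000, §3 and Table 1] [cite: Cremona2006, Table 1 (label 2718f1)] -/
theorem natCard_ker_nsmul_three_adicCompletion_eq_one_2718f1 (W' : WeierstrassCurve ℚ)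
    (hW' : W' = ⟨1, -1, 0, -99, 409⟩) {v : HeightOneSpectrum (𝓞 ℚ)} (hv : (primesEquiv v : ℕ) = 3) :
    Nat.card (nsmulAddMonoidHom 3 : (W'.baseChange (v.adicCompletion ℚ)).toAffine.Point →+
      (W'.baseChange (v.adicCompletion ℚ)).toAffine.Point).ker = 1 :=
  natCard_ker_nsmul_three_adicCompletion_eq_one_of_check 1 (-1) 0 (-99) 409 (by decide +kernel)
    (k := 2) (cert := [((4 : ℤ), 1, 3, 0)]) (by decide +kernel) W' (by rw [hW']; norm_num) hv

end Summit.BirchSwinnertonDyer.Rank1Residual.GaloisImage.LocalTorsion3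

end
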